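import Summits.HubbardSuperconductivity.HubbardSuperconductivity.Theorems.AnisotropyChordTransferFibre3FinX3Eval

/-!
# Route `AnisotropyChord` / H0 rotor rung: FIN per-`L` GM₃ (X5), `L = 27` — rows `N₁` / D / side-condition cell facts, part `p17`

Kernel facts (`decide +kernel`) for cert cells 53, 54 of the per-`L` grid of `L = 27`: `xbnCellAny2` (row `N₁` on XB2 point wedges recomputed in the kernel, exporting the literal brackets `nt ⊇ T⁺ − 3λ₂` and `tb ⊇ T⁺·D`), `xdCellAnyN0` (row D, reads `nt`), `sdCellAnyZN` (side condition, reads `nt`); evaluators `…FinX3Eval` / `…FinX5Eval`; constants from the compiled design probe (x3probe/x3plan, margins c ×0.985, b ×1.03, aD ×1.03); assembled in `…FinX5GM3TwentySeven`.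
Prover seat `hubbard-h0-rotor-p3` g8; helper for piece A = stmt-HubbardSuperconductivity-23918 of rung 19089 (`--supports`, helper class).
WHAT THIS IS NOT: nothing here proves superconductivity in the Hubbard model (rotor TARGET as worded stays FALSE, g15 verdict); kernel facts for the FIN certificate of ONE conditional reduction.  Tree imports only; zero data; standard axioms.
-/

set_option linter.dupNamespace false
set_option autoImplicit false

namespace Summit.HubbardSuperconductivity.HubbardSuperconductivity.Theorems.AnisotropyChord.Transfer.Fibre3

namespace FinXD

open FinXB FinCell Hole2

set_option maxHeartbeats 4000000 in
/-- row `N₁` of cell 53 of `L = 27` (`c = 121/200`), exporting `nt`, `tb`. [folklore] -/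
theorem xn27_53 : xbnCellAny2 27 (49/50 : ℚ) 271369354058750 278153587910219 (121/200 : ℚ) ((-2719121853638 : ℤ), (3120231874556 : ℤ)) ((811383971401334 : ℤ), (837585964526491 : ℤ)) = true := by decide +kernel

set_option maxHeartbeats 4000000 in
/-- row D of cell 53 of `L = 27` (`aD = 83/1000`). [folklore] -/
theorem xd27_53 : xdCellAnyN0 27 (49/50 : ℚ) 271369354058750 278153587910219 (83/1000 : ℚ) ((-2719121853638 : ℤ), (3120231874556 : ℤ)) = true := by decide +kernel

set_option maxHeartbeats 4000000 in
/-- side condition of cell 53 of `L = 27` (`c, b = 61/100, aD`). [folklore] -/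
theorem sd27_53 : sdCellAnyZN 27 (49/50 : ℚ) 100 271369354058750 278153587910219 ((121/200 : ℚ), (61 : ℕ), (83/1000 : ℚ)) ((-2719121853638 : ℤ), (3120231874556 : ℤ)) = true := by decide +kernel

set_option maxHeartbeats 4000000 in
/-- row `N₁` of cell 54 of `L = 27` (`c = 121/200`), exporting `nt`, `tb`. [folklore] -/
theorem xn27_54 : xbnCellAny2 27 (49/50 : ℚ) 278153587910219 285107427607975 (121/200 : ℚ) ((-2693309593296 : ℤ), (3130883281953 : ℤ)) ((831762360993051 : ℤ), (858458259250188 : ℤ)) = true := by decide +kernel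

set_option maxHeartbeats 4000000 in
/-- row D of cell 54 of `L = 27` (`aD = 83/1000`). [folklore] -/
theorem xd27_54 : xdCellAnyN0 27 (49/50 : ℚ) 278153587910219 285107427607975 (83/1000 : ℚ) ((-2693309593296 : ℤ), (3130883281953 : ℤ)) = true := by decide +kernel

set_option maxHeartbeats 4000000 in
/-- side condition of cell 54 of `L = 27` (`c, b = 61/100, aD`). [folklore] -/
theorem sd27_54 : sdCellAnyZN 27 (49/50 : ℚ) 100 278153587910219 285107427607975 ((121/200 : ℚ), (61 : ℕ), (83/1000 : ℚ)) ((-2693309593296 : ℤ), (3130883281953 : ℤ)) = true := by decide +kernel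

end FinXD

end Summit.HubbardSuperconductivity.HubbardSuperconductivity.Theorems.AnisotropyChord.Transfer.Fibre3
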